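import Summits.ResolutionOfSingularities.ResolutionOfSingularities.Theorems.CofactorCutCells
import Summits.ResolutionOfSingularities.ResolutionOfSingularities.Theorems.TameContactInsep
import Summits.ResolutionOfSingularities.ResolutionOfSingularities.Theorems.ContactFreeIsPPower
import Summits.ResolutionOfSingularities.ResolutionOfSingularities.Theorems.MaxContactCutTauChainCut
import Summits.ResolutionOfSingularities.ResolutionOfSingularities.Theorems.MaxContactCutLatencyCut
import HarnessLib

/-! # CofactorCutRoot — decomp-res-lens-4 g39 «CofactorCut», FILE D (§128 the re-rooting theorem `noForcedTowers_of_g39`: 30253 from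
exactly the hypotheses of `noForcedTowers_of_g22` with `NoContactFreeOffLocusTowers` unfolded into the port, CELL B, C₄, D₄ and the g39 core in
minimal currency; control `noForcedTowers_of_g38_residual`). -/

set_option linter.dupNamespace false
set_option linter.unusedSectionVars false

noncomputable section

open CategoryTheory AlgebraicGeometry IsLocalRing TopologicalSpace
open Literature.AlgebraicGeometry.Resolution
open Summit.ResolutionOfSingularities.ResolutionOfSingularities.Theses
open Summit.ResolutionOfSingularities.ResolutionOfSingularities.Theorems
open WeakOrderReduction ForcedTowerClasses DivergentTowerClasses MonomialTowerClasses
open HugDimensionClasses HugDimensionKernels SurfaceShadowClasses SurfaceShadowKernels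
open NearPointCut (SingularClass)
open Scheme.IdealSheafData (vanishingIdeal)

universe u

namespace Summit.ResolutionOfSingularities.ResolutionOfSingularities.Theorems.HugValuationCut

/-! ## ══ FILE D `Theorems/CofactorCutRoot.lean` (§128; imports FILE C + the LANDED `TameContactInsep`, `ContactFreeIsPPower`) ══ -/

section CofactorRoot

/-! ## §128 (g39 · NEW · RE-ROOTING) THE MINIMAL-CURRENCY DECISION FED INTO THE TREE'S ROOT CONSUMER

The per-weight chain BY NAME (g22 `ftt_step_of_g22` ← `contactFreeOffLocus_iff_wild` ← `wildContactFreeOffLocus_iff_pPower` ← g24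
`wildPPowerOffLocus_iff_g24` + `wildPPowerJumpFree_of_contact` ← g25 ← g26 + `wildCompanionJumpFree_of_contact` ← g27 ← g29 ← g30 ←
g32 (port) ← g34 ← g38 (port) ← g39 `…_iff_g39_of_lower`) and the strong induction on the weight (pattern of g16's
`forcedTowersTerminate_of_g16`): 30253 `MaxContactCut.NoForcedTowers` from EXACTLY the side hypotheses of the current root assembly
`noForcedTowers_of_g22` with its (O, contact-free) hypothesis `NoContactFreeOffLocusTowers` UNFOLDED along the lens-4 column into the
port `SurfaceChainPort`, CELL B, C₄, D₄ (open, as at g38) and THE g39 CORE IN MINIMAL CURRENCY `∀ n ≥ 1, MinimalAt n → C₃♮ʳᶠ♯ᵏ♯(n)`. -/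

/-- **the lens-4 column at weight `n` re-assembled from the g39 cells** (ports: `SurfaceChainPort`; 31571 at the weight; the lower
weights): (O, wild, contact-free)(n). [folklore] -/
theorem wildContactFreeOffLocus_of_g39 (h640 : SurfaceChainPort) {n : ℕ} (hn : 1 ≤ n) (h71 : ContactHuggingTowersTerminate n)
    (hlow : ∀ n' : ℕ, 1 ≤ n' → n' < n → ForcedTowersTerminate n')
    (hB : WildLatentFactorNonThreefoldMixedWallFreeFreshJumpShallowCompanionKangarooTowersTerminate n)
    (hK : WildOccultDivisorialThreefoldNonLineRecurrentCompanionCurveFreeBirthRecurrentCofactorBirthRecurrentMixedWallFreeFreshJumpShallowCompanionKangarooTowersTerminate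
      n)
    (hC4 : WildOccultDivisorialNonThreefoldMixedWallFreeFreshJumpShallowCompanionKangarooTowersTerminate n)
    (hD4 : WildOccultNonDivisorialNonThreefoldMixedWallFreeFreshJumpShallowCompanionKangarooTowersTerminate n) :
    WildContactFreeOffLocusTowersTerminate n := by
  have h38 : WildOccultDivisorialThreefoldNonLineRecurrentCompanionCurveFreeBirthRecurrentMixedWallFreeFreshJumpShallowCompanionKangarooTowersTerminate n :=
    (wildOccultDivisorialThreefoldNonLineRecurrentCompanionCurveFreeBirthRecurrentMixed_iff_g39_of_lower n hlow).mpr hK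
  have hC : WildOccultDivisorialMixedWallFreeFreshJumpShallowCompanionKangarooTowersTerminate n :=
    (wildOccultDivisorialMixed_iff_g38_of_port h640 n).mpr ⟨h38, hC4⟩
  have hMx : WildMixedWallFreeFreshJumpShallowCompanionKangarooTowersTerminate n :=
    (wildMixedWallFreeFreshJumpShallow_iff_g34 hn).mpr ⟨hB, hC, hD4⟩
  have hW : WildWallFreeFreshJumpShallowCompanionKangarooTowersTerminate n := (wildWallFreeFreshJumpShallow_iff_g32 h640 hn).mpr hMx
  have hFr : WildFreshJumpShallowCompanionKangarooTowersTerminate n := (wildFreshJumpShallow_iff_g30 n).mpr hW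
  have hSh : WildShallowCompanionKangarooTowersTerminate n := (wildShallowCompanionKangaroo_iff_g29 n).mpr hFr
  have hCK : WildCompanionKangarooTowersTerminate n := (wildCompanionKangaroo_iff_g27 hn).mpr hSh
  have hKD : WildKangarooOffDoublePointTowersTerminate n :=
    wildKangarooOffDoublePoint_iff_g26.mpr ⟨wildCompanionJumpFree_of_contact h71, hCK⟩
  have hKO : WildKangarooOffLocusTowersTerminate n := (wildKangarooOffLocus_iff_g25 n).mpr hKD
  have hPP : WildPPowerOffLocusTowersTerminate n := wildPPowerOffLocus_iff_g24.mpr ⟨wildPPowerJumpFree_of_contact h71, hKO⟩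
  exact (wildContactFreeOffLocus_iff_pPower hn).mpr hPP

/-- g22's (O, contact-free) cell at weight `n` from the g39 cells. [folklore] -/
theorem contactFreeOffLocus_of_g39 (h640 : SurfaceChainPort) {n : ℕ} (hn : 1 ≤ n) (h71 : ContactHuggingTowersTerminate n)
    (hlow : ∀ n' : ℕ, 1 ≤ n' → n' < n → ForcedTowersTerminate n')
    (hB : WildLatentFactorNonThreefoldMixedWallFreeFreshJumpShallowCompanionKangarooTowersTerminate n)
    (hK : WildOccultDivisorialThreefoldNonLineRecurrentCompanionCurveFreeBirthRecurrentCofactorBirthRecurrentMixedWallFreeFreshJumpShallowCompanionKangarooTowersTerminate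
      n)
    (hC4 : WildOccultDivisorialNonThreefoldMixedWallFreeFreshJumpShallowCompanionKangarooTowersTerminate n)
    (hD4 : WildOccultNonDivisorialNonThreefoldMixedWallFreeFreshJumpShallowCompanionKangarooTowersTerminate n) :
    ContactFreeOffLocusTowersTerminate n :=
  contactFreeOffLocus_iff_wild.mpr (wildContactFreeOffLocus_of_g39 h640 hn h71 hlow hB hK hC4 hD4)

/-- **KERNEL — THE ROOT PIECE at weight `n` from the g39 cells** = `ftt_step_of_g22` with its (O, contact-free) hypothesis assembled
from the lens-4 column (the core in minimal currency: `hK` is only used together with `hlow`). [folklore] -/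
theorem ftt_step_of_g39 {n : ℕ} (hn : 1 ≤ n) (hMo : MonomialCorner n) (hC : CurveLaw n) (hSL : SurfaceLaw n)
    (hH : HypersurfaceHuggingTowersTerminate n) (hP : ShadowPort n) (hM : MarkingPort n) (hDesc : DescentPort n)
    (hFC : FactorContactPort n) (hCo : CouplingPort n) (hRi : RiderPort n) (h71 : ContactHuggingTowersTerminate n)
    (h640 : SurfaceChainPort)
    (hB : WildLatentFactorNonThreefoldMixedWallFreeFreshJumpShallowCompanionKangarooTowersTerminate n)
    (hK : WildOccultDivisorialThreefoldNonLineRecurrentCompanionCurveFreeBirthRecurrentCofactorBirthRecurrentMixedWallFreeFreshJumpShallowCompanionKangarooTowersTerminate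
      n)
    (hC4 : WildOccultDivisorialNonThreefoldMixedWallFreeFreshJumpShallowCompanionKangarooTowersTerminate n)
    (hD4 : WildOccultNonDivisorialNonThreefoldMixedWallFreeFreshJumpShallowCompanionKangarooTowersTerminate n)
    (hNP : ContactFreeNonPrincipalInLocusTowersTerminate n) (hPu : PurePrincipalTowersTerminate n)
    (hR : IncommensurableWildDriftingImperfectTowersTerminate n)
    (hlow : ∀ n' : ℕ, 1 ≤ n' → n' < n → ForcedTowersTerminate n') : ForcedTowersTerminate n :=
  ftt_step_of_g22 hn hMo hC hSL hH hP hM hDesc hFC hCo hRi h71 (contactFreeOffLocus_of_g39 h640 hn h71 hlow hB hK hC4 hD4) hNP hPu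
    hR hlow

/-- **THE ROOT PIECE AT EVERY WEIGHT BY STRONG INDUCTION ON THE WEIGHT (the re-rooting theorem)** — `∀ n ≥ 1, ForcedTowersTerminate n`
from EXACTLY the hypotheses of `noForcedTowers_of_g22` with `NoContactFreeOffLocusTowers` unfolded into the port `SurfaceChainPort`,
CELL B, C₄, D₄ and THE g39 LOCATED CORE IN MINIMAL CURRENCY `∀ n ≥ 1, MinimalAt n → C₃♮ʳᶠ♯ᵏ♯(n)`; the (KFB)-half never appears: at
weight `n` it is discharged by `…CofactorBirthFreeMixed_of_minimal` from the induction hypothesis. [folklore] -/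
theorem forcedTowersTerminate_of_g39 (hMo : MaxContactCut.MonomialCornerAll) (hC : MaxContactCut.CurveLawAll)
    (hSL : MaxContactCut.SurfaceLawAll) (hH : MaxContactCut.NoHypersurfaceHuggingTowers) (hP : ShadowPortAll)
    (hM : MarkingPortAll) (hDesc : DescentPortAll) (hFC : FactorContactPortAll) (hCo : CouplingPortAll) (hRi : RiderPortAll)
    (h71 : MaxContactCut.NoContactHuggingTowers) (h640 : SurfaceChainPort) (hB : NoWildLatentFactorNonThreefoldMixedTowers)
    (hcore : ∀ n : ℕ, 1 ≤ n → MinimalAt n →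
      WildOccultDivisorialThreefoldNonLineRecurrentCompanionCurveFreeBirthRecurrentCofactorBirthRecurrentMixedWallFreeFreshJumpShallowCompanionKangarooTowersTerminate n)
    (hC4 : NoWildOccultDivisorialNonThreefoldMixedTowers) (hD4 : NoWildOccultNonDivisorialNonThreefoldMixedTowers)
    (hNP : NoContactFreeNonPrincipalInLocusTowers) (hPu : NoPurePrincipalTowers) (hR : NoIncommensurableWildDriftingImperfectTowers) :
    ∀ n : ℕ, 1 ≤ n → ForcedTowersTerminate n := by
  intro n
  induction n using Nat.strong_induction_on with
  | _ n ih =>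
    intro hn
    have hlow : ∀ n' : ℕ, 1 ≤ n' → n' < n → ForcedTowersTerminate n' := fun n' h1 h2 => ih n' h2 h1
    exact ftt_step_of_g39 hn (hMo n hn) (hC n hn) (hSL n hn) (hH n hn) (hP n hn) (hM n hn) (hDesc n hn) (hFC n hn) (hCo n hn)
      (hRi n hn) (h71 n hn) h640 (hB n hn) (hcore n hn hlow) (hC4 n hn) (hD4 n hn) (hNP n hn) (hPu n hn) (hR n hn) hlow

/-- **30253 `MaxContactCut.NoForcedTowers` BY NAME from the g39 cells (core in minimal currency), 31571, CELL B, C₄, D₄ and the ports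
of `noForcedTowers_of_g22`.** [folklore] -/
theorem noForcedTowers_of_g39 (hMo : MaxContactCut.MonomialCornerAll) (hC : MaxContactCut.CurveLawAll)
    (hSL : MaxContactCut.SurfaceLawAll) (hH : MaxContactCut.NoHypersurfaceHuggingTowers) (hP : ShadowPortAll)
    (hM : MarkingPortAll) (hDesc : DescentPortAll) (hFC : FactorContactPortAll) (hCo : CouplingPortAll) (hRi : RiderPortAll)
    (h71 : MaxContactCut.NoContactHuggingTowers) (h640 : SurfaceChainPort) (hB : NoWildLatentFactorNonThreefoldMixedTowers)
    (hcore : ∀ n : ℕ, 1 ≤ n → MinimalAt n →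
      WildOccultDivisorialThreefoldNonLineRecurrentCompanionCurveFreeBirthRecurrentCofactorBirthRecurrentMixedWallFreeFreshJumpShallowCompanionKangarooTowersTerminate n)
    (hC4 : NoWildOccultDivisorialNonThreefoldMixedTowers) (hD4 : NoWildOccultNonDivisorialNonThreefoldMixedTowers)
    (hNP : NoContactFreeNonPrincipalInLocusTowers) (hPu : NoPurePrincipalTowers) (hR : NoIncommensurableWildDriftingImperfectTowers) :
    MaxContactCut.NoForcedTowers :=
  forcedTowersTerminate_of_g39 hMo hC hSL hH hP hM hDesc hFC hCo hRi h71 h640 hB hcore hC4 hD4 hNP hPu hR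

/-- the same from the ABSOLUTE g39 located residual by name (which trivially gives the core in minimal currency). [folklore] -/
theorem noForcedTowers_of_g39_residual (hMo : MaxContactCut.MonomialCornerAll) (hC : MaxContactCut.CurveLawAll)
    (hSL : MaxContactCut.SurfaceLawAll) (hH : MaxContactCut.NoHypersurfaceHuggingTowers) (hP : ShadowPortAll)
    (hM : MarkingPortAll) (hDesc : DescentPortAll) (hFC : FactorContactPortAll) (hCo : CouplingPortAll) (hRi : RiderPortAll)
    (h71 : MaxContactCut.NoContactHuggingTowers) (h640 : SurfaceChainPort) (hB : NoWildLatentFactorNonThreefoldMixedTowers)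
    (hres : NoWildOccultCofactorBirthRecurrentCurveFreeCompanionNonLineMixedTowers)
    (hNP : NoContactFreeNonPrincipalInLocusTowers) (hPu : NoPurePrincipalTowers) (hR : NoIncommensurableWildDriftingImperfectTowers) :
    MaxContactCut.NoForcedTowers :=
  noForcedTowers_of_g39 hMo hC hSL hH hP hM hDesc hFC hCo hRi h71 h640 hB (fun n hn _ => hres.1.1 n hn) hres.1.2 hres.2 hNP hPu hR

/-- **CONTROL (g38 currency, BY NAME): the same root consumer fed by the g38 chain** — `noForcedTowers_of_g22` with
`NoContactFreeOffLocusTowers` rebuilt from 31571, the port, CELL B and the g38 located residual by the tree's ∀-weight links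
(`noWildContactFreeOffLocusTowers_iff_g32`, `noWildMixed…_iff_g38_of_port`, `noContactFreeOffLocusTowers_iff_beds`); §128 replaces
exactly `hres₃₈` by (`hcore` in minimal currency, C₄, D₄). [folklore] -/
theorem noForcedTowers_of_g38_residual (hMo : MaxContactCut.MonomialCornerAll) (hC : MaxContactCut.CurveLawAll)
    (hSL : MaxContactCut.SurfaceLawAll) (hH : MaxContactCut.NoHypersurfaceHuggingTowers) (hP : ShadowPortAll)
    (hM : MarkingPortAll) (hDesc : DescentPortAll) (hFC : FactorContactPortAll) (hCo : CouplingPortAll) (hRi : RiderPortAll)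
    (h71 : MaxContactCut.NoContactHuggingTowers) (h640 : SurfaceChainPort) (hB : NoWildLatentFactorNonThreefoldMixedTowers)
    (hres : NoWildOccultBirthRecurrentCurveFreeCompanionNonLineMixedTowers)
    (hNP : NoContactFreeNonPrincipalInLocusTowers) (hPu : NoPurePrincipalTowers) (hR : NoIncommensurableWildDriftingImperfectTowers) :
    MaxContactCut.NoForcedTowers :=
  noForcedTowers_of_g22 hMo hC hSL hH hP hM hDesc hFC hCo hRi h71
    (noContactFreeOffLocusTowers_iff_beds.mpr
      ⟨(noWildContactFreeOffLocusTowers_iff_g32 h71 h640).mpr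
          ((noWildMixedWallFreeFreshJumpShallowCompanionKangarooTowers_iff_g38_of_port h640).mpr ⟨hB, hres⟩),
        fun _ _ => tameInsepContactFreeOffLocus_holds⟩)
    hNP hPu hR

end CofactorRoot

end Summit.ResolutionOfSingularities.ResolutionOfSingularities.Theorems.HugValuationCut
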